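import Mathlib
import HarnessLib
import Summits.AtomisticToContinuum.BoseEinsteinCondensation.Theorems.NumberPhaseSandwichKinematicCalculus
import Summits.AtomisticToContinuum.BoseEinsteinCondensation.Theorems.NumberPhaseSandwichKinematicFloor
import Summits.AtomisticToContinuum.BoseEinsteinCondensation.Theorems.NumberPhaseSandwichBumpNBody
import Literature.MathematicalPhysics.QuantumManyBody.BoseGasFreeDirichletBEC
import Literature.MathematicalPhysics.QuantumManyBody.OneParticleMarginals
import Literature.MathematicalPhysics.QuantumManyBody.BoseGasProductState
import Literature.MathematicalPhysics.QuantumManyBody.LiebYngvasonBoxBound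

/-! # NumberPhaseSandwich · the near-pivot fluctuation floor from local statistics — part 1 of 2 (casts, Bose symmetry, the three integral comparisons, the core floor; split at 400 lines by the landing seat)

KERNEL PROOF of the registered stub `stub_nearPivot_of_kinematic : ShellFloorP → PairMixedMomentP →
PairSecondMomentP → StubNearPivot` of line «kinematic-near-pivot» (crux `FluctuationFloor`,
stmt-AtomisticToContinuum-32638, route NumberPhaseSandwich; decomp-a2c lens-6 g10): the kinematic (uncertainty)
floor `⟨|∇G|²⟩² ≤ Var_Ψ(G)·(2‖∇G·∇Ψ‖ + ‖ΔG Ψ‖)²` (`NumberPhaseSandwichKinematicFloor.kinematic_floor`) for the dressed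
pair generator `G = Σ_p (h_c − h_c')(x_p)` combined with the bump calculus (`NumberPhaseSandwichBumpCalculus`:
`|∇G|² ≥ (4c_σ/ℓ)²·#shell`, `|∇G|² ≤ 3(16C_σ/ℓ)² N_P`, `‖∇G·∇Ψ‖² ≤ |∇G|² Σ_{p∈P}|∇_pΨ|²`, `|ΔG| ≤ 3(2C₂/ℓ²) N_P`)
and the three local statistics I1 (shell mass `≥ c₁ρℓ³`), I2 (`∫ N_P k_P ≤ Cρ³ℓ⁶`), I3 (`⟨N_P²⟩ ≤ Cρ²ℓ⁶`) gives
`Var ≥ (16c_σ²c₁ρ)² / (2√(768C_σ²C₂'ρ³)·ℓ + √(36C₂²C₃ρ²))²` and `ℓ = L/2^k < 2^(m+1)/√ρ` in the window `K ≤ k + m`.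
The statements `ShellFloorP`, `PairMixedMomentP`, `PairSecondMomentP`, `StubNearPivot` (and the abbreviations they
use) are VERBATIM copies of the registered skeleton `Cruxes/FluctuationFloor/Lines/…kinematic….lean`. -/

noncomputable section

namespace Summit.AtomisticToContinuum.BoseEinsteinCondensation.Theorems.NumberPhaseSandwichNearPivotCompare

open Literature.MathematicalPhysics.QuantumManyBody.BoseGas hiding gradSq
open MeasureTheory Set Filter
open Summit.AtomisticToContinuum.BoseEinsteinCondensation.Theorems.NumberPhaseSandwichBumpCalculus
open scoped ENNReal NNReal
open Summit.AtomisticToContinuum.BoseEinsteinCondensation.Theorems.NumberPhaseSandwichBumpProfile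
open Summit.AtomisticToContinuum.BoseEinsteinCondensation.Theorems.NumberPhaseSandwichBumpNBody
open Summit.AtomisticToContinuum.BoseEinsteinCondensation.Theorems.NumberPhaseSandwichKinematicCalculus

variable {N M : ℕ} {L ℓ : ℝ}

/-! ## Casts `ℝ → ℝ≥0∞` -/

/-- cast of a `{0,1}`-indicator to `ℝ≥0∞`. -/
theorem ofReal_indicator_one {α : Type*} (S : Set α) (x : α) :
    ENNReal.ofReal (S.indicator (fun _ => (1 : ℝ)) x) = S.indicator (fun _ => (1 : ℝ≥0∞)) x := by
  by_cases hx : x ∈ S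
  · simp [Set.indicator_of_mem hx]
  · simp [Set.indicator_of_notMem hx]

/-- `N_P(X)` (the skeleton's `pairCount`, side `ℓ` explicit). -/
abbrev pairCountL (ℓ : ℝ) (c c' : SubIdx M) (X : Config N) : ℝ≥0∞ :=
  ∑ p : Fin N, (subCell ℓ c ∪ subCell ℓ c').indicator (fun _ => (1 : ℝ≥0∞)) (X p)

/-- `k_P(X)` (the skeleton's `pairKin`, side `ℓ` explicit). -/
abbrev pairKinL (ℓ : ℝ) (c c' : SubIdx M) (Ψ : Config N → ℂ) (X : Config N) : ℝ≥0∞ :=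
  ∑ p : Fin N, (subCell ℓ c ∪ subCell ℓ c').indicator (fun _ => (1 : ℝ≥0∞)) (X p) *
    ∑ j : Fin 3, (‖fderiv ℝ Ψ X (Pi.single p (EuclideanSpace.single j (1 : ℝ)))‖₊ : ℝ≥0∞) ^ 2

/-- number of particles on the gradient shell of `c`. -/
abbrev shellCountL (ℓ : ℝ) (c : SubIdx M) (X : Config N) : ℝ≥0∞ :=
  ∑ p : Fin N, (shell ℓ c).indicator (fun _ => (1 : ℝ≥0∞)) (X p)

/-- cast of `Σ_p 1_P(x_p)`. -/
theorem ofReal_sum_pairInd (c c' : SubIdx M) (X : Config N) :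
    ENNReal.ofReal (∑ p : Fin N, pairInd ℓ c c' (X p)) = pairCountL ℓ c c' X := by
  rw [ENNReal.ofReal_sum_of_nonneg (fun p _ => pairInd_nonneg c c' (X p))]
  exact Finset.sum_congr rfl fun p _ => ofReal_indicator_one _ _

/-- cast of `Σ_p 1_shell(x_p)`. -/
theorem ofReal_sum_shellInd (c : SubIdx M) (X : Config N) :
    ENNReal.ofReal (∑ p : Fin N, shellInd ℓ c (X p)) = shellCountL ℓ c X := by
  rw [ENNReal.ofReal_sum_of_nonneg (fun p _ => Set.indicator_nonneg (fun _ _ => zero_le_one) _)]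
  exact Finset.sum_congr rfl fun p _ => ofReal_indicator_one _ _

/-- cast of the pair-region kinetic density. -/
theorem ofReal_pairKin (c c' : SubIdx M) (Ψ : Config N → ℂ) (X : Config N) :
    ENNReal.ofReal (∑ p : Fin N, pairInd ℓ c c' (X p) * ∑ j : Fin 3, ‖fderiv ℝ Ψ X (dirVec p j)‖ ^ 2) =
      pairKinL ℓ c c' Ψ X := by
  rw [ENNReal.ofReal_sum_of_nonneg (fun p _ => mul_nonneg (pairInd_nonneg c c' (X p))
    (Finset.sum_nonneg fun j _ => sq_nonneg _))]
  refine Finset.sum_congr rfl fun p _ => ?_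
  rw [ENNReal.ofReal_mul (pairInd_nonneg c c' (X p)), ofReal_indicator_one,
    ENNReal.ofReal_sum_of_nonneg (fun j _ => sq_nonneg _)]
  congr 1
  exact Finset.sum_congr rfl fun j _ => ofReal_norm_sq_eq _

/-! ## Bose symmetry: `∫ (Σ_p 1_S(x_p)) |Ψ|² = ∫_S ρ_Ψ` -/

/-- Bose symmetry: `∫ (Σ_p 1_S(x_p)) ‖Ψ‖² = ∫_S ρ_Ψ` for a measurable `S` (marginal identity). -/
theorem lintegral_shellCount_eq (Ψ : TrialState (N + 1) L) {S : Set Space} (hS : MeasurableSet S) :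
    ∫⁻ X, (∑ p : Fin (N + 1), S.indicator (fun _ => (1 : ℝ≥0∞)) (X p)) * (‖Ψ.ψ X‖₊ : ℝ≥0∞) ^ 2 =
      ∫⁻ x in S, oneParticleDensity (N + 1) Ψ.ψ x := by
  have hψm : Measurable Ψ.ψ := Ψ.contDiff.continuous.measurable
  have hnorm : Measurable fun X : Config (N + 1) => (‖Ψ.ψ X‖₊ : ℝ≥0∞) ^ 2 :=
    hψm.nnnorm.coe_nnreal_ennreal.pow_const 2
  have hcoord : ∀ p : Fin (N + 1), Measurable fun X : Config (N + 1) => X p := fun p => measurable_pi_apply p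
  have hind : ∀ p : Fin (N + 1), Measurable fun X : Config (N + 1) => S.indicator (fun _ => (1 : ℝ≥0∞)) (X p) :=
    fun p => (measurable_const.indicator hS).comp (hcoord p)
  have hterm : ∀ p : Fin (N + 1), ∫⁻ X, S.indicator (fun _ => (1 : ℝ≥0∞)) (X p) * (‖Ψ.ψ X‖₊ : ℝ≥0∞) ^ 2 =
      ∫⁻ X, S.indicator (fun _ => (1 : ℝ≥0∞)) (X 0) * (‖Ψ.ψ X‖₊ : ℝ≥0∞) ^ 2 := by
    intro p
    calc ∫⁻ X, S.indicator (fun _ => (1 : ℝ≥0∞)) (X p) * (‖Ψ.ψ X‖₊ : ℝ≥0∞) ^ 2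
        = ∫⁻ X, (fun Y : Config (N + 1) => S.indicator (fun _ => (1 : ℝ≥0∞)) (Y 0) * (‖Ψ.ψ Y‖₊ : ℝ≥0∞) ^ 2)
            (X ∘ Equiv.swap 0 p) := by
          refine lintegral_congr fun X => ?_
          simp only [Function.comp_apply, Equiv.swap_apply_left, Ψ.symm]
      _ = ∫⁻ X, S.indicator (fun _ => (1 : ℝ≥0∞)) (X 0) * (‖Ψ.ψ X‖₊ : ℝ≥0∞) ^ 2 :=
          lintegral_comp_perm (Equiv.swap 0 p)
            (fun Y : Config (N + 1) => S.indicator (fun _ => (1 : ℝ≥0∞)) (Y 0) * (‖Ψ.ψ Y‖₊ : ℝ≥0∞) ^ 2)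
  have hslice : ∀ x : Space, S.indicator (fun _ => (1 : ℝ≥0∞)) x * sliceMass Ψ.ψ x =
      ∫⁻ Y : Config N, S.indicator (fun _ => (1 : ℝ≥0∞)) x * (‖Ψ.ψ (Matrix.vecCons x Y)‖₊ : ℝ≥0∞) ^ 2 := by
    intro x
    rw [sliceMass, lintegral_const_mul _ (measurable_nnnorm_vecCons_sq hψm x)]
  calc ∫⁻ X, (∑ p : Fin (N + 1), S.indicator (fun _ => (1 : ℝ≥0∞)) (X p)) * (‖Ψ.ψ X‖₊ : ℝ≥0∞) ^ 2
      = ∫⁻ X, ∑ p : Fin (N + 1), S.indicator (fun _ => (1 : ℝ≥0∞)) (X p) * (‖Ψ.ψ X‖₊ : ℝ≥0∞) ^ 2 := by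
        refine lintegral_congr fun X => ?_; rw [Finset.sum_mul]
    _ = ∑ p : Fin (N + 1), ∫⁻ X, S.indicator (fun _ => (1 : ℝ≥0∞)) (X p) * (‖Ψ.ψ X‖₊ : ℝ≥0∞) ^ 2 :=
        lintegral_finsetSum _ fun p _ => (hind p).mul hnorm
    _ = (N + 1 : ℝ≥0∞) * ∫⁻ X, S.indicator (fun _ => (1 : ℝ≥0∞)) (X 0) * (‖Ψ.ψ X‖₊ : ℝ≥0∞) ^ 2 := by
        simp only [hterm, Finset.sum_const, Finset.card_univ, Fintype.card_fin, nsmul_eq_mul]; push_cast; ring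
    _ = (N + 1 : ℝ≥0∞) * ∫⁻ x, ∫⁻ Y : Config N,
          S.indicator (fun _ => (1 : ℝ≥0∞)) x * (‖Ψ.ψ (Matrix.vecCons x Y)‖₊ : ℝ≥0∞) ^ 2 := by
        have h := lintegral_lintegral_vecCons (F := fun X : Config (N + 1) =>
          S.indicator (fun _ => (1 : ℝ≥0∞)) (X 0) * (‖Ψ.ψ X‖₊ : ℝ≥0∞) ^ 2) ((hind 0).mul hnorm)
        simp only [Matrix.cons_val_zero] at h
        rw [h]
    _ = (N + 1 : ℝ≥0∞) * ∫⁻ x, S.indicator (fun _ => (1 : ℝ≥0∞)) x * sliceMass Ψ.ψ x := by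
        simp only [hslice]
    _ = (N + 1 : ℝ≥0∞) * ∫⁻ x in S, sliceMass Ψ.ψ x := by
        rw [← lintegral_indicator hS]
        congr 1
        refine lintegral_congr fun x => ?_
        by_cases hx : x ∈ S
        · simp [Set.indicator_of_mem hx]
        · simp [Set.indicator_of_notMem hx]
    _ = ∫⁻ x in S, oneParticleDensity (N + 1) Ψ.ψ x := by
        rw [← lintegral_const_mul _ (measurable_sliceMass hψm)]
        rfl

/-- the gradient shell is a measurable set (a product of closed coordinate intervals). -/
theorem measurableSet_shell (ℓ : ℝ) (c : SubIdx M) : MeasurableSet (shell ℓ c) := by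
  have hi : ∀ i : Fin 3, Measurable fun x : Space => x i :=
    fun i => (EuclideanSpace.proj i : Space →L[ℝ] ℝ).continuous.measurable
  have h1 : MeasurableSet {x : Space | ℓ * ((c 0 : ℕ) : ℝ) + ℓ / 16 ≤ x 0} := measurableSet_le measurable_const (hi 0)
  have h2 : MeasurableSet {x : Space | x 0 ≤ ℓ * ((c 0 : ℕ) : ℝ) + 3 * ℓ / 16} :=
    measurableSet_le (hi 0) measurable_const
  have h3 : ∀ i : Fin 3, MeasurableSet {x : Space | i ≠ 0 →
      ℓ * ((c i : ℕ) : ℝ) + ℓ / 4 ≤ x i ∧ x i ≤ ℓ * ((c i : ℕ) : ℝ) + 3 * ℓ / 4} := by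
    intro i
    by_cases h : i = 0
    · have : {x : Space | i ≠ 0 → ℓ * ((c i : ℕ) : ℝ) + ℓ / 4 ≤ x i ∧ x i ≤ ℓ * ((c i : ℕ) : ℝ) + 3 * ℓ / 4} =
          Set.univ := by
        ext x; simp [h]
      rw [this]; exact MeasurableSet.univ
    · have : {x : Space | i ≠ 0 → ℓ * ((c i : ℕ) : ℝ) + ℓ / 4 ≤ x i ∧ x i ≤ ℓ * ((c i : ℕ) : ℝ) + 3 * ℓ / 4} =
          {x : Space | ℓ * ((c i : ℕ) : ℝ) + ℓ / 4 ≤ x i} ∩ {x : Space | x i ≤ ℓ * ((c i : ℕ) : ℝ) + 3 * ℓ / 4} := by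
        ext x; simp [h]
      rw [this]; exact (measurableSet_le measurable_const (hi i)).inter (measurableSet_le (hi i) measurable_const)
  have heq : shell ℓ c = ({x : Space | ℓ * ((c 0 : ℕ) : ℝ) + ℓ / 16 ≤ x 0} ∩
      {x : Space | x 0 ≤ ℓ * ((c 0 : ℕ) : ℝ) + 3 * ℓ / 16}) ∩
      ⋂ i : Fin 3, {x : Space | i ≠ 0 → ℓ * ((c i : ℕ) : ℝ) + ℓ / 4 ≤ x i ∧ x i ≤ ℓ * ((c i : ℕ) : ℝ) + 3 * ℓ / 4} := by
    ext x
    simp only [Set.mem_setOf_eq, Set.mem_inter_iff, Set.mem_iInter]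
    exact ⟨fun ⟨a, b, h⟩ => ⟨⟨a, b⟩, h⟩, fun ⟨⟨a, b⟩, h⟩ => ⟨a, b, h⟩⟩
  rw [heq]
  exact (h1.inter h2).inter (MeasurableSet.iInter h3)

/-! ## The three integral comparisons for `g = h_c − h_c'` -/

section Compare

/-- bridge: the kinematic-calculus file's `gradSq / lapG / DPsi / G` are the bump-calculus ones (same text). -/
theorem kin_gradSq_eq (g : Space → ℝ) (X : Config N) :
    Summit.AtomisticToContinuum.BoseEinsteinCondensation.Theorems.NumberPhaseSandwichKinematicCalculus.gradSq g X =
      gradSq g X := rfl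
/-- bridge for `lapG` (rfl). -/
theorem kin_lapG_eq (g : Space → ℝ) (X : Config N) :
    Summit.AtomisticToContinuum.BoseEinsteinCondensation.Theorems.NumberPhaseSandwichKinematicCalculus.lapG g X =
      lapG g X := rfl
/-- bridge for `DPsi` (rfl). -/
theorem kin_DPsi_eq (g : Space → ℝ) (ψ : Config N → ℂ) (X : Config N) :
    Summit.AtomisticToContinuum.BoseEinsteinCondensation.Theorems.NumberPhaseSandwichKinematicCalculus.DPsi g ψ X =
      DPsi g ψ X := rfl
/-- bridge for `G` (rfl). -/
theorem kin_G_eq (g : Space → ℝ) (X : Config N) :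
    Summit.AtomisticToContinuum.BoseEinsteinCondensation.Theorems.NumberPhaseSandwichKinematicCalculus.G g X =
      G g X := rfl

variable (Ψ : TrialState N L) (c c' : SubIdx M)

/-- the kinematic floor (`kinematic_floor`) in bump-calculus vocabulary, `g = h_c − h_c'`. -/
theorem kinFloor (m : ℂ) :
    (∫ X, gradSq (gpair ℓ c c') X * ‖Ψ.ψ X‖ ^ 2) ^ 2 ≤
      (∫ X, ‖(G (gpair ℓ c c') X : ℂ) - m‖ ^ 2 * ‖Ψ.ψ X‖ ^ 2) *
        (2 * Real.sqrt (∫ X, ‖DPsi (gpair ℓ c c') Ψ.ψ X‖ ^ 2) +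
          Real.sqrt (∫ X, lapG (gpair ℓ c c') X ^ 2 * ‖Ψ.ψ X‖ ^ 2)) ^ 2 :=
  Summit.AtomisticToContinuum.BoseEinsteinCondensation.Theorems.NumberPhaseSandwichKinematicFloor.kinematic_floor
    Ψ (contDiff_gpair (m := 2) ℓ c c') m

/-- `∫⁻`-form of the second moment of `G(gpair)` about `m`. -/
theorem lintegral_moment_eq (m : ℂ) :
    ∫⁻ X, (‖(G (gpair ℓ c c') X : ℂ) - m‖₊ : ℝ≥0∞) ^ 2 * (‖Ψ.ψ X‖₊ : ℝ≥0∞) ^ 2 =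
      ENNReal.ofReal (∫ X, ‖(G (gpair ℓ c c') X : ℂ) - m‖ ^ 2 * ‖Ψ.ψ X‖ ^ 2) :=
  Summit.AtomisticToContinuum.BoseEinsteinCondensation.Theorems.NumberPhaseSandwichKinematicFloor.lintegral_moment_eq_ofReal
    Ψ (contDiff_gpair (m := 2) ℓ c c') m

/-- integrability of `|∇G|²‖Ψ‖²`. -/
theorem integrable_gradSq_normSq : Integrable fun X => gradSq (gpair ℓ c c') X * ‖Ψ.ψ X‖ ^ 2 :=
  Summit.AtomisticToContinuum.BoseEinsteinCondensation.Theorems.NumberPhaseSandwichKinematicCalculus.integrable_mul_of_cs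
    (Summit.AtomisticToContinuum.BoseEinsteinCondensation.Theorems.NumberPhaseSandwichKinematicFloor.continuous_gradSq
      (contDiff_gpair (m := 2) ℓ c c'))
    (Ψ.contDiff.continuous.norm.pow 2)
    (Summit.AtomisticToContinuum.BoseEinsteinCondensation.Theorems.NumberPhaseSandwichKinematicCalculus.hasCompactSupport_normSq Ψ)

/-- integrability of `(ΔG)²‖Ψ‖²`. -/
theorem integrable_lapGSq_normSq : Integrable fun X => lapG (gpair ℓ c c') X ^ 2 * ‖Ψ.ψ X‖ ^ 2 :=
  Summit.AtomisticToContinuum.BoseEinsteinCondensation.Theorems.NumberPhaseSandwichKinematicCalculus.integrable_mul_of_cs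
    ((Summit.AtomisticToContinuum.BoseEinsteinCondensation.Theorems.NumberPhaseSandwichKinematicFloor.continuous_lapG
      (contDiff_gpair (m := 2) ℓ c c')).pow 2)
    (Ψ.contDiff.continuous.norm.pow 2)
    (Summit.AtomisticToContinuum.BoseEinsteinCondensation.Theorems.NumberPhaseSandwichKinematicCalculus.hasCompactSupport_normSq Ψ)

/-- integrability of `‖∇G·∇Ψ‖²`. -/
theorem integrable_DPsiSq : Integrable fun X => ‖DPsi (gpair ℓ c c') Ψ.ψ X‖ ^ 2 :=
  Summit.AtomisticToContinuum.BoseEinsteinCondensation.Theorems.NumberPhaseSandwichKinematicCalculus.integrable_sq_of_cs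
    (Summit.AtomisticToContinuum.BoseEinsteinCondensation.Theorems.NumberPhaseSandwichKinematicFloor.continuous_DPsi
      Ψ (contDiff_gpair (m := 2) ℓ c c')).norm
    (Summit.AtomisticToContinuum.BoseEinsteinCondensation.Theorems.NumberPhaseSandwichKinematicFloor.hasCompactSupport_DPsi
      (g := gpair ℓ c c') Ψ).norm

/-- **T-comparison**: `‖∇G·∇Ψ‖₂² ≤ 3(16C_σ/ℓ)² · ∫ N_P k_P`. -/
theorem T_le (hℓ : 0 < ℓ) {C : ℝ} (hC : ∀ x : ℝ, |sigmaDeriv x| ≤ C) :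
    ENNReal.ofReal (∫ X, ‖DPsi (gpair ℓ c c') Ψ.ψ X‖ ^ 2) ≤
      ENNReal.ofReal (3 * (16 * C / ℓ) ^ 2) * ∫⁻ X, pairCountL ℓ c c' X * pairKinL ℓ c c' Ψ.ψ X := by
  rw [ofReal_integral_eq_lintegral_ofReal (integrable_DPsiSq Ψ c c') (Eventually.of_forall fun X => sq_nonneg _),
    ← lintegral_const_mul' _ _ ENNReal.ofReal_ne_top]
  refine lintegral_mono fun X => ?_
  rw [← ofReal_sum_pairInd, ← ofReal_pairKin, ← ENNReal.ofReal_mul (Finset.sum_nonneg fun p _ => pairInd_nonneg c c' _),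
    ← ENNReal.ofReal_mul (by positivity)]
  refine ENNReal.ofReal_le_ofReal ?_
  have hS : 0 ≤ ∑ p : Fin N, pairInd ℓ c c' (X p) * ∑ j : Fin 3, ‖fderiv ℝ Ψ.ψ X (dirVec p j)‖ ^ 2 :=
    Finset.sum_nonneg fun p _ => mul_nonneg (pairInd_nonneg c c' _) (Finset.sum_nonneg fun j _ => sq_nonneg _)
  calc ‖DPsi (gpair ℓ c c') Ψ.ψ X‖ ^ 2
      ≤ gradSq (gpair ℓ c c') X *
          ∑ p : Fin N, pairInd ℓ c c' (X p) * ∑ j : Fin 3, ‖fderiv ℝ Ψ.ψ X (dirVec p j)‖ ^ 2 :=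
        norm_DPsi_gpair_sq_le hℓ hC c c' Ψ.ψ X
    _ ≤ (3 * (16 * C / ℓ) ^ 2 * ∑ p : Fin N, pairInd ℓ c c' (X p)) *
          ∑ p : Fin N, pairInd ℓ c c' (X p) * ∑ j : Fin 3, ‖fderiv ℝ Ψ.ψ X (dirVec p j)‖ ^ 2 :=
        mul_le_mul_of_nonneg_right (gradSq_gpair_le hℓ hC c c' X) hS
    _ = 3 * (16 * C / ℓ) ^ 2 * ((∑ p : Fin N, pairInd ℓ c c' (X p)) *
          ∑ p : Fin N, pairInd ℓ c c' (X p) * ∑ j : Fin 3, ‖fderiv ℝ Ψ.ψ X (dirVec p j)‖ ^ 2) := by ring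

/-- **C-comparison**: `‖ΔG Ψ‖₂² ≤ (6C₂/ℓ²)² · ⟨N_P²⟩`. -/
theorem C_le (hℓ : 0 < ℓ) {C₂ : ℝ} (hC₂ : ∀ t : ℝ, |deriv tauDeriv t| ≤ C₂) :
    ENNReal.ofReal (∫ X, lapG (gpair ℓ c c') X ^ 2 * ‖Ψ.ψ X‖ ^ 2) ≤
      ENNReal.ofReal ((3 * (2 * C₂ / ℓ ^ 2)) ^ 2) * ∫⁻ X, pairCountL ℓ c c' X ^ 2 * (‖Ψ.ψ X‖₊ : ℝ≥0∞) ^ 2 := by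
  rw [ofReal_integral_eq_lintegral_ofReal (integrable_lapGSq_normSq Ψ c c')
    (Eventually.of_forall fun X => mul_nonneg (sq_nonneg _) (sq_nonneg _)),
    ← lintegral_const_mul' _ _ ENNReal.ofReal_ne_top]
  refine lintegral_mono fun X => ?_
  rw [← ofReal_sum_pairInd, ← ofReal_norm_sq_eq, ← ENNReal.ofReal_pow (Finset.sum_nonneg fun p _ => pairInd_nonneg c c' _),
    ← ENNReal.ofReal_mul (by positivity), ← ENNReal.ofReal_mul (by positivity)]
  refine ENNReal.ofReal_le_ofReal ?_
  have h := abs_lapG_gpair_le (N := N) hℓ hC₂ c c' X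
  have hsq : lapG (gpair ℓ c c') X ^ 2 ≤ (3 * (2 * C₂ / ℓ ^ 2) * ∑ p : Fin N, pairInd ℓ c c' (X p)) ^ 2 := by
    rw [← sq_abs]; exact pow_le_pow_left₀ (abs_nonneg _) h 2
  calc lapG (gpair ℓ c c') X ^ 2 * ‖Ψ.ψ X‖ ^ 2
      ≤ (3 * (2 * C₂ / ℓ ^ 2) * ∑ p : Fin N, pairInd ℓ c c' (X p)) ^ 2 * ‖Ψ.ψ X‖ ^ 2 :=
        mul_le_mul_of_nonneg_right hsq (sq_nonneg _)
    _ = (3 * (2 * C₂ / ℓ ^ 2)) ^ 2 * ((∑ p : Fin N, pairInd ℓ c c' (X p)) ^ 2 * ‖Ψ.ψ X‖ ^ 2) := by ring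

/-- **A-comparison** (lower bound): `(4c_σ/ℓ)² · ∫ (#shell) |Ψ|² ≤ ⟨|∇G|²⟩`. -/
theorem A_ge (hℓ : 0 < ℓ) {cσ : ℝ} (hcσ0 : 0 ≤ cσ) (hcσ : ∀ x ∈ Icc (1 / 4 : ℝ) (3 / 4), cσ ≤ sigmaDeriv x)
    (hcc : c ≠ c') :
    ENNReal.ofReal ((4 * cσ / ℓ) ^ 2) * ∫⁻ X, shellCountL ℓ c X * (‖Ψ.ψ X‖₊ : ℝ≥0∞) ^ 2 ≤
      ENNReal.ofReal (∫ X, gradSq (gpair ℓ c c') X * ‖Ψ.ψ X‖ ^ 2) := by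
  rw [ofReal_integral_eq_lintegral_ofReal (integrable_gradSq_normSq Ψ c c') (Eventually.of_forall fun X =>
    mul_nonneg (Finset.sum_nonneg fun p _ => Finset.sum_nonneg fun j _ => sq_nonneg _) (sq_nonneg _)),
    ← lintegral_const_mul' _ _ ENNReal.ofReal_ne_top]
  refine lintegral_mono fun X => ?_
  rw [← ofReal_sum_shellInd, ← ofReal_norm_sq_eq,
    ← ENNReal.ofReal_mul (Finset.sum_nonneg fun p _ => Set.indicator_nonneg (fun _ _ => zero_le_one) _),
    ← ENNReal.ofReal_mul (by positivity)]
  refine ENNReal.ofReal_le_ofReal ?_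
  calc (4 * cσ / ℓ) ^ 2 * ((∑ p : Fin N, shellInd ℓ c (X p)) * ‖Ψ.ψ X‖ ^ 2)
      = ((4 * cσ / ℓ) ^ 2 * ∑ p : Fin N, shellInd ℓ c (X p)) * ‖Ψ.ψ X‖ ^ 2 := by ring
    _ ≤ gradSq (gpair ℓ c c') X * ‖Ψ.ψ X‖ ^ 2 :=
        mul_le_mul_of_nonneg_right (gradSq_gpair_ge hℓ hcσ0 hcσ hcc X) (sq_nonneg _)

end Compare

/-! ## The floor from the three comparisons -/

section Core

variable (Ψ : TrialState N L) (c c' : SubIdx M)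

/-- kinematic floor + the three comparisons: `α²/(2√τ+√γ)² ≤ Var_Ψ(G)` whenever `α ≤ ⟨|∇G|²⟩`, `‖∇G·∇Ψ‖² ≤ τ`,
`‖ΔG Ψ‖² ≤ γ` (the degenerate denominator gives the junk value `0`, trivially below `Var`). -/
theorem floor_core {α τ γ : ℝ} (hα : 0 ≤ α) (hτ : 0 ≤ τ) (hγ : 0 ≤ γ)
    (hA : ENNReal.ofReal α ≤ ENNReal.ofReal (∫ X, gradSq (gpair ℓ c c') X * ‖Ψ.ψ X‖ ^ 2))
    (hT : ENNReal.ofReal (∫ X, ‖DPsi (gpair ℓ c c') Ψ.ψ X‖ ^ 2) ≤ ENNReal.ofReal τ)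
    (hC : ENNReal.ofReal (∫ X, lapG (gpair ℓ c c') X ^ 2 * ‖Ψ.ψ X‖ ^ 2) ≤ ENNReal.ofReal γ) :
    ENNReal.ofReal (α ^ 2 / (2 * Real.sqrt τ + Real.sqrt γ) ^ 2) ≤
      ⨅ m : ℂ, ∫⁻ X, (‖(G (gpair ℓ c c') X : ℂ) - m‖₊ : ℝ≥0∞) ^ 2 * (‖Ψ.ψ X‖₊ : ℝ≥0∞) ^ 2 := by
  have hA0 : 0 ≤ ∫ X, gradSq (gpair ℓ c c') X * ‖Ψ.ψ X‖ ^ 2 := integral_nonneg fun X =>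
    mul_nonneg (Finset.sum_nonneg fun p _ => Finset.sum_nonneg fun j _ => sq_nonneg _) (sq_nonneg _)
  have hαA : α ≤ ∫ X, gradSq (gpair ℓ c c') X * ‖Ψ.ψ X‖ ^ 2 := (ENNReal.ofReal_le_ofReal_iff hA0).1 hA
  have hTτ : ∫ X, ‖DPsi (gpair ℓ c c') Ψ.ψ X‖ ^ 2 ≤ τ := (ENNReal.ofReal_le_ofReal_iff hτ).1 hT
  have hCγ : ∫ X, lapG (gpair ℓ c c') X ^ 2 * ‖Ψ.ψ X‖ ^ 2 ≤ γ := (ENNReal.ofReal_le_ofReal_iff hγ).1 hC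
  have hD0 : 0 ≤ 2 * Real.sqrt τ + Real.sqrt γ := by positivity
  refine le_iInf fun m => ?_
  rw [lintegral_moment_eq Ψ c c' m]
  refine ENNReal.ofReal_le_ofReal ?_
  have hV0 : 0 ≤ ∫ X, ‖(G (gpair ℓ c c') X : ℂ) - m‖ ^ 2 * ‖Ψ.ψ X‖ ^ 2 :=
    integral_nonneg fun X => mul_nonneg (sq_nonneg _) (sq_nonneg _)
  have hkin := kinFloor (ℓ := ℓ) Ψ c c' m
  have hDle : 2 * Real.sqrt (∫ X, ‖DPsi (gpair ℓ c c') Ψ.ψ X‖ ^ 2) +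
      Real.sqrt (∫ X, lapG (gpair ℓ c c') X ^ 2 * ‖Ψ.ψ X‖ ^ 2) ≤ 2 * Real.sqrt τ + Real.sqrt γ :=
    add_le_add (mul_le_mul_of_nonneg_left (Real.sqrt_le_sqrt hTτ) (by norm_num)) (Real.sqrt_le_sqrt hCγ)
  have hkin' : (∫ X, gradSq (gpair ℓ c c') X * ‖Ψ.ψ X‖ ^ 2) ^ 2 ≤
      (∫ X, ‖(G (gpair ℓ c c') X : ℂ) - m‖ ^ 2 * ‖Ψ.ψ X‖ ^ 2) * (2 * Real.sqrt τ + Real.sqrt γ) ^ 2 :=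
    hkin.trans (mul_le_mul_of_nonneg_left (pow_le_pow_left₀ (by positivity) hDle 2) hV0)
  rcases hD0.eq_or_lt with hD | hD
  · rw [← hD, zero_pow two_ne_zero, div_zero]; exact hV0
  · rw [div_le_iff₀ (pow_pos hD 2)]
    exact (pow_le_pow_left₀ hα hαA 2).trans hkin'

end Core

/-- pure arithmetic: the floor constant is monotone in the cell side through the window bound `ℓ ≤ B`. -/
theorem const_arith {κA κT κC ℓ B : ℝ} (hκT : 0 ≤ κT) (hκC : 0 < κC) (hℓ : 0 < ℓ) (hℓB : ℓ ≤ B) :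
    κA ^ 2 / (2 * Real.sqrt κT * B + Real.sqrt κC) ^ 2 ≤
      (κA * ℓ) ^ 2 / (2 * Real.sqrt (κT * ℓ ^ 4) + Real.sqrt (κC * ℓ ^ 2)) ^ 2 := by
  have h4 : Real.sqrt (κT * ℓ ^ 4) = Real.sqrt κT * ℓ ^ 2 := by
    rw [Real.sqrt_mul hκT, show ℓ ^ 4 = (ℓ ^ 2) ^ 2 by ring, Real.sqrt_sq (by positivity)]
  have h2 : Real.sqrt (κC * ℓ ^ 2) = Real.sqrt κC * ℓ := by
    rw [Real.sqrt_mul hκC.le, Real.sqrt_sq hℓ.le]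
  rw [h4, h2]
  have hCpos : 0 < Real.sqrt κC := Real.sqrt_pos.2 hκC
  have hTnn : 0 ≤ Real.sqrt κT := Real.sqrt_nonneg κT
  have hpos : 0 < 2 * Real.sqrt κT * ℓ + Real.sqrt κC := by positivity
  have hle : 2 * Real.sqrt κT * ℓ + Real.sqrt κC ≤ 2 * Real.sqrt κT * B + Real.sqrt κC := by nlinarith
  have key : (κA * ℓ) ^ 2 / (2 * (Real.sqrt κT * ℓ ^ 2) + Real.sqrt κC * ℓ) ^ 2 =
      κA ^ 2 / (2 * Real.sqrt κT * ℓ + Real.sqrt κC) ^ 2 := by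
    rw [show 2 * (Real.sqrt κT * ℓ ^ 2) + Real.sqrt κC * ℓ = (2 * Real.sqrt κT * ℓ + Real.sqrt κC) * ℓ by ring,
      mul_pow, mul_pow, mul_div_mul_right _ _ (pow_ne_zero 2 hℓ.ne')]
  rw [key]
  exact div_le_div_of_nonneg_left (sq_nonneg κA) (pow_pos hpos 2) (pow_le_pow_left₀ hpos.le hle 2)

/-- the window bound: `K ≤ k + m`, `k ≤ K`, `L/2^K < 2/√ρ` give `ℓ = L/2^k ≤ 2^(m+1)/√ρ`. -/
theorem ell_le_window {ρ L : ℝ} {K k m : ℕ} (hL : 0 ≤ L) (hK2 : L / 2 ^ K < 2 * (1 / Real.sqrt ρ))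
    (hkK : k ≤ K) (hKkm : K ≤ k + m) : L / 2 ^ k ≤ 2 ^ (m + 1) * (1 / Real.sqrt ρ) := by
  obtain ⟨d, rfl⟩ := Nat.exists_eq_add_of_le hkK
  have hd : d ≤ m := by omega
  have h1 : L / 2 ^ k = L / 2 ^ (k + d) * 2 ^ d := by
    rw [pow_add]; field_simp
  rw [h1]
  have h2 : (2 : ℝ) ^ d ≤ 2 ^ m := pow_le_pow_right₀ (by norm_num) hd
  have h3 : 0 ≤ L / 2 ^ (k + d) := by positivity
  have h4 : 0 ≤ 2 * (1 / Real.sqrt ρ) := by positivity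
  calc L / 2 ^ (k + d) * 2 ^ d ≤ 2 * (1 / Real.sqrt ρ) * 2 ^ m := mul_le_mul hK2.le h2 (by positivity) h4
    _ = 2 ^ (m + 1) * (1 / Real.sqrt ρ) := by rw [pow_succ]; ring

end Summit.AtomisticToContinuum.BoseEinsteinCondensation.Theorems.NumberPhaseSandwichNearPivotCompare

end
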